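import Summits.NavierStokesRegularity.NavierStokesRegularity.Theorems.CoriolisHeadNoCoRotatingCoreKFoldExtremeRotation
import Summits.NavierStokesRegularity.NavierStokesRegularity.Theorems.CoriolisHeadNoCoRotatingCoreOfPineauVicol
import Summits.NavierStokesRegularity.NavierStokesRegularity.Theorems.QuantisedSymmetryPolyhedralDssProfileExistsStubAncientMildOfClassicalTypeI
import Summits.NavierStokesRegularity.NavierStokesRegularity.Theorems.LiouvilleConjectureNS
import Summits.NavierStokesRegularity.NavierStokesRegularity.Theorems.TypeIDSSLiouvilleConjecture
import Literature.Analysis.FluidPDE.TypeIAncientMild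
import HarnessLib

/-!
# CoriolisHeadNoCoRotatingCoreOfLiouvilleConjectures — crux `NoCoRotatingCore` (stmt-NavierStokesRegularity-22676)
# sits BELOW the two named Liouville walls of the summit: (L) `LiouvilleConjectureNS` and `TypeIDSSLiouvilleConjecture`

Support file (`--supports stmt-NavierStokesRegularity-22676 --as helper`; theorems only, no definitions, no named facts):
two DICTIONARY EDGES BY NAME for the board.  The crux is equivalent to Pineau–Vicol's Conjecture 1.1 as printed
(`noCoRotatingCore_iff_pineauVicolConjecture`, p650800); this file proves

* `pineauVicolConjecture_of_liouvilleConjectureNS` / **`noCoRotatingCore_of_liouvilleConjectureNS :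
  LiouvilleConjectureNS → CoriolisHead.NoCoRotatingCore`** — under the Liouville conjecture (L) of
  Koch–Nadirashvili–Seregin–Šverák (bounded ancient mild solutions are constant; the summit's conjecture leaf
  `Summit.….LiouvilleConjectureNS`) every smooth Pineau–Vicol-frame profile with Type-I decay vanishes, at EVERY
  rotation rate (α = 0 included): its ansatz field is a classical Type-I solution on `(−∞,0)`
  (`exists_isClassicalNSSolutionOn_pvAnsatz_of_profile`, `hasTypeIDecay_pvAnsatz_of_profile`), hence a Type-I ancient
  field in the KNSS mild gauge (`isTypeIAncientMild_of_classical_typeI`, KNSS 2009 Thm 6.1), whose past translates are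
  bounded ancient mild solutions; (L) makes every slice constant and the Type-I rate sends the constant to `0`
  (`IsTypeIAncientMild.eq_zero_of_slice_const`); at `t = −1` the field is `U`.
* `pineauVicolConjecture_of_typeIDSSLiouville` / **`noCoRotatingCore_of_typeIDSSLiouvilleConjecture :
  TypeIDSSLiouvilleConjecture → CoriolisHead.NoCoRotatingCore`** — under the Type-I DSS Liouville wall
  (Bradshaw–Tsai OP 5.1 / Tsai GSM 192 Conj. 8.8, the summit's conjecture leaf `Summit.….TypeIDSSLiouvilleConjecture`;
  only its UNROTATED conjunct at the factors `c = e^{π/|α|}` is used): for `α ≠ 0` the ansatz field of a profile is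
  `c`-DSS with `c = e^{π/|α|}` (Remark 1.5 = `isDiscretelySelfSimilar_pvAnsatz_of_kFold` at `k = 1`), ancient mild with
  measurable slices and Type-I, so the wall makes its slices vanish a.e., hence everywhere (continuity).

Both then feed the landed composition `noCoRotatingCore_of_pineauVicolConjecture` (rescue line S1/S2/S3a/S3b + frame
reduction).  So on the wall board: **22676 ⟸ (L)** and **22676 ⟸ Type-I DSS Liouville** (the latter needed only on the
factor range `[e^{π/α₂(K)}, e^{π/α₁(K)}]` per Type-I constant `K`, by Pineau–Vicol Thm 1.4).

HONEST FRAMING.  CONDITIONAL bridges on OPEN conjectures; neither (L), nor the DSS wall, nor `NoCoRotatingCore`, nor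
PV Conjecture 1.1, nor Navier–Stokes regularity is proved here.

References: G. Koch, N. Nadirashvili, G. Seregin, V. Šverák, Acta Math. 203 (2009), §1 conjecture (L), Thm 6.1
[KochNadirashviliSereginSverak2009]; Z. Bradshaw, T.-P. Tsai, Comm. PDE 42 (2017) §5 OP 5.1 [BradshawTsai2017CPDE];
B. Pineau, V. Vicol, arXiv:2607.09619 (2026), Conj. 1.1, Remark 1.5, Thm 1.4 [PineauVicol2026].
-/

noncomputable section

-- the summit and its single sub-problem share the name (CONVENTIONS §1), as in every Theorems file
set_option linter.dupNamespace false

open Set Function Filter MeasureTheory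
open Literature.Analysis.FluidPDE Literature.Analysis.FluidPDE.PineauVicol2026
open Summit.NavierStokesRegularity.NavierStokesRegularity.Theses
open Summit.NavierStokesRegularity.NavierStokesRegularity (LiouvilleConjectureNS TypeIDSSLiouvilleConjecture)
open Summit.NavierStokesRegularity.NavierStokesRegularity.Theorems.PolyhedralDssProfileExists.Birth
  (isTypeIAncientMild_of_classical_typeI)
open scoped RealInnerProductSpace Laplacian ContDiff Topology

namespace Summit.NavierStokesRegularity.NavierStokesRegularity.Theorems.CoriolisHead

/-! ## §1 The ansatz field of a profile is a Type-I ancient field in the KNSS mild gauge -/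

/-- **Profile ⇒ Type-I KNSS-mild ancient field.**  For a smooth solution `(U, P)` of the Pineau–Vicol-frame profile
system with `‖U(y)‖ ≤ K/(1 + ‖y‖)`, the ansatz field `u = pvAnsatz α U` is a Type-I ancient field in the KNSS mild gauge
with constant `K` (`IsTypeIAncientMild K u`). [cite: KochNadirashviliSereginSverak2009, Thm 6.1 (arXiv:0709.3599)] -/
theorem isTypeIAncientMild_pvAnsatz_of_profile {α K : ℝ}
    {U : EuclideanSpace ℝ (Fin 3) → EuclideanSpace ℝ (Fin 3)} {P : EuclideanSpace ℝ (Fin 3) → ℝ}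
    (hU : ContDiff ℝ (⊤ : ℕ∞) U) (hP : ContDiff ℝ 2 P) (hdiv : VectorCalculus.IsDivFree U)
    (heq : ∀ y, α • (rotGen (U y) - fderiv ℝ U y (rotGen y)) + (1 / 2 : ℝ) • U y
      + (1 / 2 : ℝ) • fderiv ℝ U y y - Laplacian.laplacian U y
      + Literature.Analysis.FluidPDE.convect U U y + gradient P y = 0)
    (hdec : ∀ y, ‖U y‖ ≤ K / (1 + ‖y‖)) :
    IsTypeIAncientMild K (pvAnsatz α (fun y _ => U y)) := by
  obtain ⟨p, hp⟩ := exists_isClassicalNSSolutionOn_pvAnsatz_of_profile hU hP hdiv heq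
  exact isTypeIAncientMild_of_classical_typeI hp (hasTypeIDecay_pvAnsatz_of_profile hdec)

/-! ## §2 Edge 1: the crux below the Liouville conjecture (L) -/

/-- **(L) ⇒ Pineau–Vicol's Conjecture 1.1 (profile form), at every rotation rate.**  Under `LiouvilleConjectureNS`
every smooth solution `(U, P)` of the Pineau–Vicol-frame profile system at any rate `α` with Type-I decay
`‖U(y)‖ ≤ K/(1 + ‖y‖)` vanishes: the past translate `t ↦ u(t − δ)` of its ansatz field is a bounded ancient mild
solution, (L) makes its slices a.e. constant, continuity makes them constant, the Type-I rate makes the constants `0`,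
and `u(−1) = U`.  CONDITIONAL on the open conjecture (L).
[cite: KochNadirashviliSereginSverak2009, §1 conjecture (L) (arXiv:0709.3599)] -/
theorem pineauVicolConjecture_of_liouvilleConjectureNS (hL : LiouvilleConjectureNS) :
    ∀ (α : ℝ) (U : EuclideanSpace ℝ (Fin 3) → EuclideanSpace ℝ (Fin 3)) (P : EuclideanSpace ℝ (Fin 3) → ℝ),
      ContDiff ℝ (⊤ : ℕ∞) U → ContDiff ℝ 2 P →
      Literature.Analysis.FluidPDE.VectorCalculus.IsDivFree U →
      (∀ y, α • (rotGen (U y) - fderiv ℝ U y (rotGen y)) + (1 / 2 : ℝ) • U y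
        + (1 / 2 : ℝ) • fderiv ℝ U y y - Laplacian.laplacian U y
        + Literature.Analysis.FluidPDE.convect U U y + gradient P y = 0) →
      (∃ K : ℝ, ∀ y, ‖U y‖ ≤ K / (1 + ‖y‖)) →
      ∀ y, U y = 0 := by
  intro α U P hU hP hdiv heq hdec y
  obtain ⟨K, hK⟩ := hdec
  set u : ℝ → EuclideanSpace ℝ (Fin 3) → EuclideanSpace ℝ (Fin 3) := pvAnsatz α (fun y _ => U y) with hu
  have hT : IsTypeIAncientMild K u := isTypeIAncientMild_pvAnsatz_of_profile hU hP hdiv heq hK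
  -- the past translate `w(s) = u(s − ½)` is a bounded ancient mild solution with continuous slices
  set w : ℝ → EuclideanSpace ℝ (Fin 3) → EuclideanSpace ℝ (Fin 3) := fun s => u (s - 1 / 2) with hw
  have hwT : IsTypeIAncientMild K w := hT.comp_sub_right (by norm_num)
  have hwB : IsBoundedAncientMildSolution 1 w := hT.isBoundedAncientMildSolution_sub (by norm_num)
  have hwm : ∀ s < 0, AEStronglyMeasurable (w s) volume := fun s hs => hwT.aestronglyMeasurable_slice hs
  -- (L): every slice of `w` is a.e. constant, hence constant (continuity), hence `0` (Type-I rate)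
  have hconst : ∀ s < 0, ∃ b : EuclideanSpace ℝ (Fin 3), ∀ z, w s z = b := by
    intro s hs
    obtain ⟨b, hb⟩ := hL w hwB hwm s hs
    refine ⟨b, fun z => ?_⟩
    have hc : w s = fun _ => b := ((hwT.continuous_slice hs).ae_eq_iff_eq volume continuous_const).1 hb
    exact congrFun hc z
  choose! b hb using hconst
  have hzero : ∀ s < 0, ∀ z, w s z = 0 := fun s hs z =>
    hwT.eq_zero_of_slice_const (fun s' hs' z' => hb s' hs' z') hs z
  -- `u(−1) = w(−½) = 0` and `u(−1) = U`
  have key : u (-1) y = 0 := by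
    have h := hzero (-1 / 2) (by norm_num) y
    simp only [hw] at h
    norm_num at h
    exact h
  rwa [hu, pvAnsatz_neg_one] at key

/-- **Edge 1: crux 22676 sits below (L).**  `LiouvilleConjectureNS → CoriolisHead.NoCoRotatingCore`, by
`pineauVicolConjecture_of_liouvilleConjectureNS` and the landed composition `noCoRotatingCore_of_pineauVicolConjecture`.
CONDITIONAL on the open conjecture (L); proves neither side. [cite: KochNadirashviliSereginSverak2009, §1 conjecture (L)] -/
theorem noCoRotatingCore_of_liouvilleConjectureNS (hL : LiouvilleConjectureNS) : CoriolisHead.NoCoRotatingCore :=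
  noCoRotatingCore_of_pineauVicolConjecture fun α _ U P hU hP hdiv heq hdec =>
    pineauVicolConjecture_of_liouvilleConjectureNS hL α U P hU hP hdiv heq hdec

/-! ## §3 Edge 2: the crux below the Type-I DSS Liouville wall -/

/-- Every field is `1`-fold symmetric (`R_{2π} = 1`). [folklore] -/
theorem oneFold_symmetric (U : EuclideanSpace ℝ (Fin 3) → EuclideanSpace ℝ (Fin 3)) (y : EuclideanSpace ℝ (Fin 3)) :
    U (rotZ (2 * Real.pi / ((1 : ℕ) : ℝ)) y) = rotZ (2 * Real.pi / ((1 : ℕ) : ℝ)) (U y) := by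
  have h2π : ∀ v : EuclideanSpace ℝ (Fin 3), rotZ (2 * Real.pi / ((1 : ℕ) : ℝ)) v = v := fun v => by
    rw [Nat.cast_one, div_one, ← zero_add (2 * Real.pi), rotZ_add_two_pi', rotZ_zero]
  rw [h2π, h2π]

/-- **Type-I DSS Liouville (unrotated, at the factor `e^{π/|α|}`) ⇒ Pineau–Vicol's Conjecture 1.1 (profile form,
`α ≠ 0`).**  If the Type-I `c`-DSS Liouville statement holds at `c = e^{π/|α|}`, every smooth Pineau–Vicol-frame profile
at rate `α ≠ 0` with Type-I decay vanishes: its ansatz field is `c`-DSS (Remark 1.5), ancient mild with measurable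
slices and Type-I, so its slices vanish a.e., hence everywhere by continuity; `u(−1) = U`.  CONDITIONAL on the open wall.
[cite: BradshawTsai2017CPDE, §5 Open Problem 5.1] -/
theorem pineauVicolConjecture_of_typeIDSSLiouville {α : ℝ} (hα : α ≠ 0)
    (hW : TypeIDSSLiouville (Real.exp (Real.pi / |α|))) :
    ∀ (U : EuclideanSpace ℝ (Fin 3) → EuclideanSpace ℝ (Fin 3)) (P : EuclideanSpace ℝ (Fin 3) → ℝ),
      ContDiff ℝ (⊤ : ℕ∞) U → ContDiff ℝ 2 P →
      Literature.Analysis.FluidPDE.VectorCalculus.IsDivFree U →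
      (∀ y, α • (rotGen (U y) - fderiv ℝ U y (rotGen y)) + (1 / 2 : ℝ) • U y
        + (1 / 2 : ℝ) • fderiv ℝ U y y - Laplacian.laplacian U y
        + Literature.Analysis.FluidPDE.convect U U y + gradient P y = 0) →
      (∃ K : ℝ, ∀ y, ‖U y‖ ≤ K / (1 + ‖y‖)) →
      ∀ y, U y = 0 := by
  intro U P hU hP hdiv heq hdec y
  obtain ⟨K, hK⟩ := hdec
  set u : ℝ → EuclideanSpace ℝ (Fin 3) → EuclideanSpace ℝ (Fin 3) := pvAnsatz α (fun y _ => U y) with hu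
  have hT : IsTypeIAncientMild K u := isTypeIAncientMild_pvAnsatz_of_profile hU hP hdiv heq hK
  have hI : HasTypeIDecay K u := hasTypeIDecay_pvAnsatz_of_profile hK
  have hc1 : 1 < Real.exp (Real.pi / |α|) :=
    Real.one_lt_exp_iff.2 (div_pos Real.pi_pos (abs_pos.2 hα))
  -- `c`-DSS with `c = e^{π/|α|}`: the case `k = 1` of `isDiscretelySelfSimilar_pvAnsatz_of_kFold`
  have hdss : IsDiscretelySelfSimilar (Real.exp (Real.pi / |α|)) u := by
    have h := isDiscretelySelfSimilar_pvAnsatz_of_kFold (k := 1) hα (U := U) (oneFold_symmetric U)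
    simpa only [Nat.cast_one, one_mul] using h
  have hae := hW hc1 u hT.isAncientMildSolution (fun t ht => hT.aestronglyMeasurable_slice ht) hdss ⟨K, hI⟩
    (-1) (by norm_num)
  have h0 : u (-1) = 0 := ((hT.continuous_slice (by norm_num)).ae_eq_iff_eq volume continuous_const).1 hae
  have key := congrFun h0 y
  rwa [hu, pvAnsatz_neg_one] at key

/-- **Edge 2: crux 22676 sits below the Type-I DSS Liouville wall.**
`TypeIDSSLiouvilleConjecture → CoriolisHead.NoCoRotatingCore` (only the unrotated conjunct at the factors `e^{π/|α|}`,
`α ≠ 0`, is used), by `pineauVicolConjecture_of_typeIDSSLiouville` and `noCoRotatingCore_of_pineauVicolConjecture`.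
CONDITIONAL on the open wall; proves neither side. [cite: BradshawTsai2017CPDE, §5 Open Problem 5.1] -/
theorem noCoRotatingCore_of_typeIDSSLiouvilleConjecture (hW : TypeIDSSLiouvilleConjecture) :
    CoriolisHead.NoCoRotatingCore :=
  noCoRotatingCore_of_pineauVicolConjecture fun α hα U P hU hP hdiv heq hdec =>
    pineauVicolConjecture_of_typeIDSSLiouville hα (hW (Real.exp (Real.pi / |α|))).1 U P hU hP hdiv heq hdec

end Summit.NavierStokesRegularity.NavierStokesRegularity.Theorems.CoriolisHead

end
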